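import Mathlib
import Summits.Ventures.HodgeRepro2.A2TripleSumAssoc

/-!
# A2 annex — the degree of the Pontryagin product: `a ⋆ b ∈ H^{p+q−24}(B)` in the model

(A4.3.3) of sub-claim A2 (route/T4-A2-p6.md v6): the Gysin map `m_*` of the sum map has degree
`2(12 − 24) = −24`, so `a ⋆ b = m_*(a ⊗ b) ∈ H^{p+q−24}(B)` for `a ∈ H^p`, `b ∈ H^q`; in particular
`y = z ⋆ θ⁴ ∈ H^{20+8−24} = H⁴(B, ℚ)`.  In the twelve-plane model (`2|ι| = 24`) this file proves the
degree count from the definitions: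

* `cop_mono_mem_span_both`: `Δ(e₁ ∧ ⋯ ∧ e_n) ∈ span { mono l₁ ⊗ mono l₂ : |l₁| + |l₂| = n }`
  (the coproduct is graded; both factors controlled, signs absorbed);
* `cop_mem_span_of_mem`: for `u ∈ ⋀^n`, `Δ u ∈ span { x ⊗ y : x ∈ ⋀^p, y ∈ ⋀^q, p + q = n }`;
* `pontryaginFunctional_eq_zero_of_mem`: for `a ∈ ⋀^i`, `b ∈ ⋀^j`, the functional
  `u ↦ ∫_{B×B} (a ⊗ b) ∪ Δ u` kills `⋀^n` unless `n = 4|ι| − i − j`;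
* `repr_dualOf` / **`dualOf_mem_grading`**: the Poincaré dual of a functional supported in degree `d`
  lies in `⋀^{2|ι| − d}`;
* **`pontryagin_mem_grading`**: `a ∈ ⋀^i`, `b ∈ ⋀^j` (`i, j ≤ 2|ι|`), `2|ι| ≤ i + j ⇒
  a ⋆ b ∈ ⋀^{i + j − 2|ι|}`, and **`pontryagin_theta_pow_mem_grading`**: `z ∈ ⋀^{2|ι| − 4} ⇒
  z ⋆ θ⁴ ∈ ⋀^4` (the class `y` of Theorem A has degree `4`, as (S3) states).

Seat p6 (A2 owner), gen 16.  §8 (d): uses an L-value-free non-vanishing device: NO.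
-/

namespace Summit.Ventures.HodgeRepro2.A2PontryaginDegree

open WeilPlanes WeilIntegral WeilCoproduct WeilPairing A2TripleSumPairing A2TripleSumPairingDegree
  A2IntegralDegree A2ModelDuality A2PontryaginModel A2TripleSumAssoc
open scoped TensorProduct

variable {ι : Type*} [DecidableEq ι]

/-- Pure tensors of two sub-monomials of `mono l` whose lengths add up to `|l|`. -/
def bothSubmono (l : List (Gen ι)) : Set (AA ι) :=
  {Z | ∃ l₁ l₂ : List (Gen ι), l₁.Sublist l ∧ l₂.Sublist l ∧ l₁.length + l₂.length = l.length ∧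
    Z = mono l₁ ᵍ⊗ₜ[ℂ] mono l₂}

/-- The coproduct of a monomial, with both factors controlled: every term is
`± (sub-monomial) ⊗ (complementary sub-monomial)`. -/
theorem cop_mono_mem_span_both (l : List (Gen ι)) :
    cop (mono l) ∈ Submodule.span ℂ (bothSubmono l) := by
  induction l with
  | nil =>
    refine Submodule.subset_span ⟨[], [], List.Sublist.refl _, List.Sublist.refl _, rfl, ?_⟩
    simp [mono, one_eq_tmul_one]
  | cons g l ih =>
    rw [WeilIntegral.mono_cons, map_mul, cop_gen, add_mul]
    refine Submodule.add_mem _ ?_ ?_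
    · refine Submodule.span_induction
        (p := fun Z _ => inl (gen g) * Z ∈ Submodule.span ℂ (bothSubmono (g :: l))) ?_ ?_ ?_ ?_ ih
      · rintro Z ⟨l₁, l₂, hl₁, hl₂, hlen, rfl⟩
        rw [inl_mul_tmul, ← WeilIntegral.mono_cons]
        exact Submodule.subset_span ⟨g :: l₁, l₂, hl₁.cons_cons g, hl₂.cons g,
          by rw [List.length_cons, List.length_cons, ← hlen]; omega, rfl⟩
      · simp
      · intro Z Z' _ _ hZ hZ'
        rw [mul_add]
        exact Submodule.add_mem _ hZ hZ'
      · intro a Z _ hZ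
        rw [mul_smul_comm]
        exact Submodule.smul_mem _ a hZ
    · refine Submodule.span_induction
        (p := fun Z _ => inr (gen g) * Z ∈ Submodule.span ℂ (bothSubmono (g :: l))) ?_ ?_ ?_ ?_ ih
      · rintro Z ⟨l₁, l₂, hl₁, hl₂, hlen, rfl⟩
        rw [inr_gen_mul_mono_tmul, ← WeilIntegral.mono_cons]
        exact Submodule.smul_mem _ _ (Submodule.subset_span
          ⟨l₁, g :: l₂, hl₁.cons g, hl₂.cons_cons g,
            by rw [List.length_cons, List.length_cons, ← hlen]; omega, rfl⟩)
      · simp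
      · intro Z Z' _ _ hZ hZ'
        rw [mul_add]
        exact Submodule.add_mem _ hZ hZ'
      · intro a Z _ hZ
        rw [mul_smul_comm]
        exact Submodule.smul_mem _ a hZ

/-- Pure tensors `x ⊗ y` with `x ∈ ⋀^p`, `y ∈ ⋀^q`, `p + q = n`. -/
def gradedTensors (n : ℕ) : Set (AA ι) :=
  {Z | ∃ (p q : ℕ) (x y : A ι), x ∈ grading ι p ∧ y ∈ grading ι q ∧ p + q = n ∧ Z = x ᵍ⊗ₜ[ℂ] y}

/-- The coproduct is graded: `u ∈ ⋀^n ⇒ Δ u ∈ span { x ⊗ y : deg x + deg y = n }`. -/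
theorem cop_mem_span_of_mem [Fintype ι] {n : ℕ} {u : A ι} (hu : u ∈ grading ι n) :
    cop u ∈ Submodule.span ℂ (gradedTensors n) := by
  refine Submodule.span_induction (p := fun u _ => cop u ∈ Submodule.span ℂ (gradedTensors n))
    ?_ ?_ ?_ ?_ (exteriorPower_le_span_mono n hu)
  · rintro _ ⟨l, hl, rfl⟩
    refine Submodule.span_mono ?_ (cop_mono_mem_span_both l)
    rintro _ ⟨l₁, l₂, _, _, hlen, rfl⟩
    exact ⟨l₁.length, l₂.length, mono l₁, mono l₂, mono_mem_grading l₁, mono_mem_grading l₂,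
      hlen.trans hl, rfl⟩
  · simp
  · intro x y _ _ hx hy
    rw [map_add]
    exact Submodule.add_mem _ hx hy
  · intro a x _ hx
    rw [map_smul]
    exact Submodule.smul_mem _ a hx

/-- `(a ⊗ b) · (x ⊗ y) = ± (a ∧ x) ⊗ (b ∧ y)` for homogeneous `b`, `x`: the double integral of it
vanishes unless `deg a + deg x = deg b + deg y = 2|ι|`. -/
theorem II_inl_mul_inr_mul_tmul_eq_zero [Fintype ι] {i j p q : ℕ} {a b x y : A ι}
    (ha : a ∈ grading ι i) (hb : b ∈ grading ι j) (hx : x ∈ grading ι p) (hy : y ∈ grading ι q)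
    (h : ¬ (i + p = Fintype.card (Gen ι) ∧ j + q = Fintype.card (Gen ι))) :
    II (inl a * inr b * (x ᵍ⊗ₜ[ℂ] y)) = 0 := by
  have hmul := GradedTensorProduct.tmul_coe_mul_coe_tmul (grading ι) (grading ι) a
    (⟨b, hb⟩ : grading ι j) (⟨x, hx⟩ : grading ι p) y
  simp only at hmul
  rw [inl_mul_inr, hmul, neg_one_uzpow_smul, map_smul, II_tmul, smul_eq_mul]
  rcases Classical.not_and_iff_not_or_not.mp h with h' | h'
  · rw [integral_mul_eq_zero_of_mem_of_mem ha hx h', zero_mul, mul_zero]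
  · rw [integral_mul_eq_zero_of_mem_of_mem hb hy h', mul_zero, mul_zero]

/-- The functional `u ↦ ∫_{B×B} (a ⊗ b) ∪ Δ u` of `a ∈ ⋀^i`, `b ∈ ⋀^j` kills `⋀^n` unless
`i + j + n = 4|ι|` (the pairing lives in the top degree of `B × B`). -/
theorem pontryaginFunctional_eq_zero_of_mem [Fintype ι] {i j n : ℕ} {a b u : A ι}
    (ha : a ∈ grading ι i) (hb : b ∈ grading ι j) (hu : u ∈ grading ι n)
    (hn : i + j + n ≠ 2 * Fintype.card (Gen ι)) : pontryaginFunctional a b u = 0 := by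
  rw [pontryaginFunctional_apply]
  refine Submodule.span_induction (p := fun Z _ => II (inl a * inr b * Z) = 0) ?_ ?_ ?_ ?_
    (cop_mem_span_of_mem hu)
  · rintro _ ⟨p, q, x, y, hx, hy, hpq, rfl⟩
    refine II_inl_mul_inr_mul_tmul_eq_zero ha hb hx hy ?_
    rintro ⟨h1, h2⟩
    apply hn
    omega
  · simp
  · intro Z Z' _ _ hZ hZ'
    rw [mul_add, map_add, hZ, hZ', add_zero]
  · intro r Z _ hZ
    rw [mul_smul_comm, map_smul, hZ, smul_zero]

/-- The coordinates of the Poincaré dual: `repr (dualOf P) s = ± P (e_{sᶜ})`. -/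
theorem repr_dualOf [Fintype ι] (P : Module.Dual ℂ (A ι))
    (s : Finset (Fin (Fintype.card (Gen ι)))) :
    ∃ ε : ℂ, (ε = 1 ∨ ε = -1) ∧ (aBasis (ι := ι)).repr (dualOf P) s = ε * P (aBasis sᶜ) := by
  obtain ⟨ε, hε, h⟩ := integral_mul_aBasis_compl (dualOf P) s
  rw [integral_dualOf_mul] at h
  refine ⟨ε, hε, ?_⟩
  have hε' : ε * ε = 1 := by rcases hε with rfl | rfl <;> norm_num
  calc (aBasis (ι := ι)).repr (dualOf P) s
      = (aBasis (ι := ι)).repr (dualOf P) s * (ε * ε) := by rw [hε', mul_one]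
    _ = ε * ((aBasis (ι := ι)).repr (dualOf P) s * ε) := by ring
    _ = ε * P (aBasis sᶜ) := by rw [← h]

/-- A basis monomial indexed by `s` has degree `|s|`. -/
theorem aBasis_mem_grading [Fintype ι] (s : Finset (Fin (Fintype.card (Gen ι)))) :
    (aBasis s : A ι) ∈ grading ι s.card := by
  rw [aBasis_apply, ← length_genListOf]
  exact mono_mem_grading _

/-- **The Poincaré dual of a functional supported in degree `d` lies in degree `2|ι| − d`.** -/
theorem dualOf_mem_grading [Fintype ι] (P : Module.Dual ℂ (A ι)) (d : ℕ)
    (hP : ∀ {n : ℕ} {u : A ι}, u ∈ grading ι n → n ≠ d → P u = 0) :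
    dualOf P ∈ grading ι (Fintype.card (Gen ι) - d) := by
  rw [← (aBasis (ι := ι)).sum_repr (dualOf P)]
  refine Submodule.sum_mem _ fun s _ => ?_
  by_cases hs : s.card = Fintype.card (Gen ι) - d
  · exact Submodule.smul_mem _ _ (hs ▸ aBasis_mem_grading s)
  · obtain ⟨ε, _, h⟩ := repr_dualOf P s
    have hc : sᶜ.card ≠ d := by
      rw [Finset.card_compl, Fintype.card_fin]
      intro heq
      apply hs
      have := Finset.card_le_univ s
      rw [Fintype.card_fin] at this
      omega
    rw [h, hP (aBasis_mem_grading sᶜ) hc, mul_zero, zero_smul]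
    exact Submodule.zero_mem _

/-- **The degree of the Pontryagin product** ((A4.3.3): `m_*` has degree `−2|ι| = −24`):
`a ∈ ⋀^i`, `b ∈ ⋀^j` with `i, j ≤ 2|ι|` and `2|ι| ≤ i + j ⇒ a ⋆ b ∈ ⋀^{i + j − 2|ι|}`. -/
theorem pontryagin_mem_grading [Fintype ι] {i j : ℕ} {a b : A ι} (ha : a ∈ grading ι i)
    (hb : b ∈ grading ι j) (hi : i ≤ Fintype.card (Gen ι)) (hj : j ≤ Fintype.card (Gen ι))
    (hij : Fintype.card (Gen ι) ≤ i + j) :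
    pontryagin a b ∈ grading ι (i + j - Fintype.card (Gen ι)) := by
  have h := dualOf_mem_grading (pontryaginFunctional a b) (2 * Fintype.card (Gen ι) - (i + j))
    (fun {n} {u} hu hn => pontryaginFunctional_eq_zero_of_mem ha hb hu (by omega))
  have hcard : Fintype.card (Gen ι) - (2 * Fintype.card (Gen ι) - (i + j)) =
      i + j - Fintype.card (Gen ι) := by omega
  rw [hcard] at h
  exact h

/-- `z ∈ ⋀^{2|ι| − 4} ⇒ z ⋆ θ⁴ ∈ ⋀^4` (`|ι| ≥ 4`): the class `y` of Theorem A has degree `4`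
((S3)). -/
theorem pontryagin_theta_pow_mem_grading [Fintype ι] (hι : 4 ≤ Fintype.card ι) {z : A ι}
    (hz : z ∈ grading ι (2 * Fintype.card ι - 4)) (c : ι → ℂ) :
    pontryagin z (theta c ^ 4) ∈ grading ι 4 := by
  have h := pontryagin_mem_grading hz (theta_pow_mem_grading c 4) (by rw [card_gen]; omega)
    (by rw [card_gen]; omega) (by rw [card_gen]; omega)
  have hcard : 2 * Fintype.card ι - 4 + 2 * 4 - Fintype.card (Gen ι) = 4 := by
    rw [card_gen]; omega
  rw [hcard] at h
  exact h

end Summit.Ventures.HodgeRepro2.A2PontryaginDegree
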